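import Mathlib
import Summits.KontsevichZagierPeriods.Zeta5Search.CatalanRemarksVTDenominator
import Summits.KontsevichZagierPeriods.Zeta5Search.CatalanRemarksTwoAdic
import Summits.KontsevichZagierPeriods.Zeta5Search.CatalanRemarksUTDenominator
import HarnessLib

/-!
# Catalan box family — the inclusions (14) of Zudilin's Theorem 2 with exponent EXACTLY `4n` (clause (iii), `e ≡ 0`)

HONEST FRAMING: systematic search; no irrationality claim unless certified.  Arithmetic of two explicitly defined rational
sequences; nothing in this file is a statement about Catalan's constant (clauses (i), (ii), (ii′) of
`Zudilin2003.remarksTheorem2` — the series identity and the asymptotics — are NOT addressed and stay hypotheses in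
`remarksTheorem2_of_analytic`).

Cell `pub-zeta5`, planner seat `fam-catalan` (gen 8; gen 9 revision).  [Zudilin2002CatalanRemarks, Theorem 2, (14)] asserts
`2^{4n+o(n)}ũ_n ∈ ℤ` and `2^{4n+o(n)}D²_{2n−1}ṽ_n ∈ ℤ`.  Combining
* the odd part: `2^{6n}ũ_n ∈ ℤ`, `2^{6n}D²_{2n−1}ṽ_n ∈ ℤ` (`CatalanRemarksVTDenominator`, from the residue sum (12)), and
* the `2`-part: `v₂(ũ_n) = 5 − 4n + 2s₂(n−1)`, `v₂(ṽ_n) = 4 − 4n + 2s₂(n−1)` (`CatalanRemarksTwoAdic`, from the recursion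
  (13)),
by a Bezout step, this file proves for EVERY `n`
* `uT_twoPart_odd_den : 2^{4n}ũ_n` has odd denominator (`n ≥ 1`), `vT_inclusion_sharp : 2^{4n−4}D²_{2n−1}ṽ_n ∈ ℤ`
  (`n ≥ 1`), `vT_inclusion : 2^{4n}D²_{2n−1}ṽ_n ∈ ℤ`;
* **`remarksTheorem2_inclusions`** — clause (iii) of `Zudilin2003.remarksTheorem2` verbatim with the exponent function
  `e ≡ 0` (so `o(n) = 0`: the inclusions (14) hold with `2^{4n}` on the nose), and `remarksTheorem2_of_analytic`
  recording that only the analytic clauses of the named fact remain.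
The `u`-half `2^{4n}ũ_n ∈ ℤ` (every `n`) is the tree theorem `CatalanRemarksUTDenominator.two_pow_mul_uT_isInt`
(box identification of `ũ_n`, exact denominator `2^{4n−5−2s₂(n−1)}`); it is used by name and not re-proved here.
-/

namespace Summit.KontsevichZagierPeriods.Zeta5Search.CatalanRemarksVT

open Filter Topology
open Literature.NumberTheory.Irrationality.Zudilin2003 (uT vT RT formT remarksTheorem2)
open Summit.KontsevichZagierPeriods.Zeta5Search.CatalanRemarksTwoAdic
  (uT_succ_pos padicValRat_uT_rec vT_twoPart_odd_den den_odd_of_padicValRat_two_nonneg)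
open Summit.KontsevichZagierPeriods.Zeta5Search.CatalanRemarksUTDenominator (two_pow_mul_uT_isInt)

/-- `2^{4n}ũ_n` has ODD reduced denominator for `n ≥ 1` (`v₂(2^{4n}ũ_n) = 5 + 2s₂(n−1) ≥ 0`).
[cite: Zudilin2002CatalanRemarks, Sect. 2, Theorem 2, eq. (14)] -/
theorem uT_twoPart_odd_den {n : ℕ} (hn : 1 ≤ n) : Odd (2 ^ (4 * n) * uT n).den := by
  apply den_odd_of_padicValRat_two_nonneg
  obtain ⟨m, rfl⟩ : ∃ m, n = m + 1 := ⟨n - 1, by omega⟩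
  have hq : uT (m + 1) ≠ 0 := (uT_succ_pos m).ne'
  have h2 : padicValRat 2 (2 : ℚ) = 1 := by simpa using (padicValRat.self (p := 2) one_lt_two)
  rw [padicValRat.mul (pow_ne_zero _ two_ne_zero) hq, padicValRat.pow, h2, padicValRat_uT_rec (by omega)]
  omega

/-- **`2^{4n−4}D²_{2n−1}ṽ_n ∈ ℤ` for `n ≥ 1`** — the second inclusion of (14), sharp in the power of `2`
(`v₂(2^{4n−4}ṽ_n) = 2s₂(n−1)` vanishes exactly when `n − 1` is `0`, i.e. at `n = 1`… and whenever `s₂(n−1) = 0`; the odd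
part of `den ṽ_n` divides `D²_{2n−1}`). [cite: Zudilin2002CatalanRemarks, Sect. 2, Theorem 2, eq. (14)] -/
theorem vT_inclusion_sharp {n : ℕ} (hn : 1 ≤ n) :
    ∃ z : ℤ, (z : ℚ) = 2 ^ (4 * n - 4) * (Nat.lcmUpto (2 * n - 1) : ℚ) ^ 2 * vT n := by
  have h := isInt_of_two_pow_mul_of_odd_den ((Nat.lcmUpto (2 * n - 1) : ℤ) ^ 2) (2 ^ (4 * n - 4) * vT n)
    (2 * n + 4) ?_ (vT_twoPart_odd_den hn)
  · obtain ⟨z, hz⟩ := h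
    exact ⟨z, by rw [hz]; push_cast; ring⟩
  obtain ⟨z, hz⟩ := vT_int_odd_part n
  refine ⟨z, ?_⟩
  rw [hz, show (2 : ℚ) ^ (6 * n) = 2 ^ (2 * n + 4) * 2 ^ (4 * n - 4) by rw [← pow_add]; congr 1; omega]
  push_cast
  ring

/-- **`2^{4n}D²_{2n−1}ṽ_n ∈ ℤ` for every `n`** (second inclusion of (14) with `o(n) = 0`; `ṽ₀ = −1`).
[cite: Zudilin2002CatalanRemarks, Sect. 2, Theorem 2, eq. (14)] -/
theorem vT_inclusion (n : ℕ) : ∃ z : ℤ, (z : ℚ) = 2 ^ (4 * n) * (Nat.lcmUpto (2 * n - 1) : ℚ) ^ 2 * vT n := by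
  rcases Nat.eq_zero_or_pos n with rfl | hn
  · exact ⟨-((Nat.lcmUpto (2 * 0 - 1) : ℤ)) ^ 2, by simp [vT]⟩
  obtain ⟨z, hz⟩ := vT_inclusion_sharp hn
  refine ⟨2 ^ 4 * z, ?_⟩
  push_cast
  rw [hz, show (2 : ℚ) ^ (4 * n) = 2 ^ 4 * 2 ^ (4 * n - 4) by rw [← pow_add]; congr 1; omega]
  ring

/-- **Clause (iii) of `Zudilin2003.remarksTheorem2`, verbatim, with the exponent function `e ≡ 0`:** the inclusions (14)
`2^{4n+e(n)}ũ_n ∈ ℤ`, `2^{4n+e(n)}D²_{2n−1}ṽ_n ∈ ℤ` hold for every `n` with `e(n) = 0` (in particular `e(n)/n → 0`);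
the `u`-half is `CatalanRemarksUTDenominator.two_pow_mul_uT_isInt`, the `v`-half `vT_inclusion`.
[cite: Zudilin2002CatalanRemarks, Sect. 2, Theorem 2, eq. (14)] -/
theorem remarksTheorem2_inclusions :
    ∃ e : ℕ → ℕ, Tendsto (fun n : ℕ => (e n : ℝ) / n) atTop (𝓝 0) ∧
      ∀ n : ℕ, (∃ z : ℤ, (z : ℚ) = 2 ^ (4 * n + e n) * uT n)
        ∧ (∃ z : ℤ, (z : ℚ) = 2 ^ (4 * n + e n) * (Nat.lcmUpto (2 * n - 1) : ℚ) ^ 2 * vT n) :=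
  ⟨fun _ => 0, by simp, fun n => ⟨by simpa using two_pow_mul_uT_isInt n, by simpa using vT_inclusion n⟩⟩

/-- What remains of the named fact `Zudilin2003.remarksTheorem2` after this file: only its analytic clauses (i) the
series identity `Σ_ν (−R̃_n′(ν)) = ũ_nG − ṽ_n`, (ii) `|ũ_nG − ṽ_n|^{1/n} → ((√5−1)/2)^5`, (ii′) `ũ_n^{1/n} → ((1+√5)/2)^5`;
clause (iii) is `remarksTheorem2_inclusions`.  (No claim about those clauses is made here.)
[cite: Zudilin2002CatalanRemarks, Sect. 2, Theorem 2] -/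
theorem remarksTheorem2_of_analytic
    (h₁ : ∀ n : ℕ, 1 ≤ n → HasSum (fun ν : ℕ => -deriv (fun t : ℝ => RT n t) ((ν : ℝ) + 1)) (formT n))
    (h₂ : Tendsto (fun n : ℕ => |formT n| ^ (1 / (n : ℝ))) atTop (𝓝 (((Real.sqrt 5 - 1) / 2) ^ 5)))
    (h₃ : Tendsto (fun n : ℕ => ((uT n : ℚ) : ℝ) ^ (1 / (n : ℝ))) atTop (𝓝 (((1 + Real.sqrt 5) / 2) ^ 5))) :
    remarksTheorem2 :=
  ⟨h₁, h₂, h₃, remarksTheorem2_inclusions⟩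

/-- Sanity by name at `n = 2`: `2^8·ũ₂ = 14720` and `2^8·D₃²·ṽ₂ = 2^8·36·1897/36 = 485632` are the integers produced.
[cite: Zudilin2002CatalanRemarks, Sect. 2, values `ũ₂ = 115/2`, `ṽ₂ = 1897/36`] -/
example : (2 : ℚ) ^ (4 * 2) * uT 2 = 14720 ∧ (2 : ℚ) ^ (4 * 2) * (Nat.lcmUpto (2 * 2 - 1) : ℚ) ^ 2 * vT 2 = 485632 := by
  rw [Literature.NumberTheory.Irrationality.Zudilin2003.uT_two, Literature.NumberTheory.Irrationality.Zudilin2003.vT_two,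
    show Nat.lcmUpto (2 * 2 - 1) = 6 by decide]
  norm_num

end Summit.KontsevichZagierPeriods.Zeta5Search.CatalanRemarksVT
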